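import Summits.Ventures.HodgeRepro2.T5SU11OneParameter

/-!
# The hyperbolic subgroup `A = {a_t}` of `SU(1,1)`: a closed, non-compact, proper one-parameter subgroup

`a_t = su11 (cosh t) (sinh t)` (`T5SU11Cartan.hyp`, a one-parameter subgroup by
`T5SU11OneParameter.hyp_add / hyp_zero / hyp_neg`) is a CONTINUOUS and PROPER map `ℝ → SU(1,1)`:
`|a(a_t)| = cosh t ≥ |t|`, so the preimage of a set on which `|a(g)|` is bounded is bounded
(`tendsto_hyp_cocompact`, `isProperMap_hyp`). Hence its range, the hyperbolic subgroup
`hypSubgroup = {a_t : t ∈ ℝ}` (`Subgroup SU11`), is CLOSED (`isClosed_hypSubgroup`) and NOT compact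
(`noncompactSpace_hypSubgroup`) — the concrete closed non-compact subgroup of `SU(1,1)` to which the
Howe–Moore-type statements of the lane apply. Nothing is claimed about (N).

Blind lane: Mathlib + the HodgeRepro2 prefix only; no sorry; axioms ⊆ {propext, Classical.choice,
Quot.sound}.
-/

namespace Summit.Ventures.HodgeRepro2.T5SU11HyperbolicSubgroup

open Metric Filter Topology Set
open T5UnitaryBound T5PoincareDensity T5PoincareInvariance T5SU11Unimodular T5SU11Fibration
  T5SU11Cartan T5SU11OneParameter T5BergmanCoefficient

/-! ### Continuity of `t ↦ a_t` -/

/-- `t ↦ su11 (cosh t) (sinh t)` is continuous into `M₂(ℂ)`. -/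
lemma continuous_su11_cosh_sinh :
    Continuous fun t : ℝ => su11 (Real.cosh t : ℂ) (Real.sinh t : ℂ) := by
  refine continuous_pi fun i => continuous_pi fun j => ?_
  fin_cases i <;> fin_cases j <;> simp only [su11] <;> simp <;> fun_prop

/-- **`t ↦ a_t` is continuous.** -/
theorem continuous_hyp : Continuous hyp :=
  (continuous_su11_cosh_sinh.subtype_mk fun t =>
      (su11_memU11_det_one _ _ (normSq_cosh_sub_normSq_sinh t)).2).subtype_mk
    fun t => (mem_SU11_iff _).mpr
      (su11_memU11_det_one _ _ (normSq_cosh_sub_normSq_sinh t)).1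

/-! ### `|a(a_t)| = cosh t ≥ |t|` -/

/-- `a(a_t) = cosh t`. -/
lemma mat_hyp_zero_zero (t : ℝ) : mat (hyp t) 0 0 = (Real.cosh t : ℂ) := by
  rw [mat_hyp]
  simp [su11]

/-- `|a(a_t)| = cosh t`. -/
lemma norm_mat_hyp (t : ℝ) : ‖mat (hyp t) 0 0‖ = Real.cosh t := by
  rw [mat_hyp_zero_zero, Complex.norm_real, Real.norm_eq_abs, abs_of_pos (Real.cosh_pos t)]

/-- `|t| ≤ cosh t`. -/
lemma abs_le_cosh (t : ℝ) : |t| ≤ Real.cosh t := by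
  rw [← Real.cosh_abs]
  exact (Real.self_le_sinh_iff.2 (abs_nonneg t)).trans (Real.sinh_lt_cosh _).le

/-- `g ↦ a(g)` is continuous on `SU(1,1)`. -/
lemma continuous_mat_zero_zero : Continuous fun g : SU11 => mat g 0 0 :=
  (continuous_apply 0).comp ((continuous_apply 0).comp
    (continuous_subtype_val.comp continuous_subtype_val))

/-! ### Properness -/

/-- **`t ↦ a_t` is proper**: it carries the cocompact filter of `ℝ` to that of `SU(1,1)` (on a compact
`K ⊆ SU(1,1)`, `|a(g)|` is bounded by some `B`, while `|a(a_t)| = cosh t ≥ |t|`). -/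
theorem tendsto_hyp_cocompact : Tendsto hyp (cocompact ℝ) (cocompact SU11) := by
  rw [Filter.hasBasis_cocompact.tendsto_right_iff]
  intro K hK
  obtain ⟨B, hB⟩ := hK.bddAbove_image (continuous_norm.comp continuous_mat_zero_zero).continuousOn
  rw [Filter.eventually_iff, Filter.mem_cocompact]
  refine ⟨Icc (-B) B, isCompact_Icc, fun t ht hmem => ?_⟩
  have h1 : ‖mat (hyp t) 0 0‖ ≤ B := hB ⟨hyp t, hmem, rfl⟩
  rw [norm_mat_hyp] at h1
  have h2 : |t| ≤ B := (abs_le_cosh t).trans h1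
  exact ht (abs_le.1 h2)

/-- `t ↦ a_t` is a proper map. -/
theorem isProperMap_hyp : IsProperMap hyp :=
  isProperMap_iff_tendsto_cocompact.2 ⟨continuous_hyp, tendsto_hyp_cocompact⟩

/-- `t ↦ a_t` is injective (`cosh` is injective on `t ≥ 0` and `sinh` is injective). -/
theorem hyp_injective : Function.Injective hyp := by
  intro s t h
  have h1 : mat (hyp s) 0 1 = mat (hyp t) 0 1 := by rw [h]
  rw [mat_hyp, mat_hyp] at h1
  simp only [su11, Matrix.of_apply, Matrix.cons_val', Matrix.cons_val_one, Matrix.cons_val_zero,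
    Matrix.empty_val', Matrix.cons_val_fin_one, Complex.ofReal_inj] at h1
  exact Real.sinh_injective h1

/-- `t ↦ a_t` is a closed embedding. -/
theorem isClosedEmbedding_hyp : Topology.IsClosedEmbedding hyp :=
  Topology.IsClosedEmbedding.of_continuous_injective_isClosedMap continuous_hyp hyp_injective
    isProperMap_hyp.isClosedMap

/-! ### The hyperbolic subgroup -/

/-- **The hyperbolic subgroup** `A = {a_t : t ∈ ℝ} ≤ SU(1,1)`. -/
def hypSubgroup : Subgroup SU11 where
  carrier := Set.range hyp
  mul_mem' := by
    rintro _ _ ⟨s, rfl⟩ ⟨t, rfl⟩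
    exact ⟨s + t, hyp_add s t⟩
  one_mem' := ⟨0, hyp_zero⟩
  inv_mem' := by
    rintro _ ⟨t, rfl⟩
    exact ⟨-t, hyp_neg t⟩

/-- `g ∈ A` iff `g = a_t` for some `t`. -/
lemma mem_hypSubgroup_iff (g : SU11) : g ∈ hypSubgroup ↔ ∃ t, hyp t = g := Iff.rfl

/-- `a_t ∈ A`. -/
lemma hyp_mem_hypSubgroup (t : ℝ) : hyp t ∈ hypSubgroup := ⟨t, rfl⟩

/-- `A = range a` as a set. -/
lemma coe_hypSubgroup : (hypSubgroup : Set SU11) = Set.range hyp := rfl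

/-- **`A` is closed in `SU(1,1)`** (the range of a proper map). -/
theorem isClosed_hypSubgroup : IsClosed (hypSubgroup : Set SU11) :=
  isProperMap_hyp.isClosed_range

/-- **`A` is not compact**: `|a(a_t)| = cosh t` is unbounded on it. -/
instance noncompactSpace_hypSubgroup : NoncompactSpace hypSubgroup := by
  refine ⟨fun hc => ?_⟩
  have hK : IsCompact (Set.range hyp) := by
    have := hc.image continuous_subtype_val
    rwa [Set.image_univ, Subtype.range_coe, coe_hypSubgroup] at this
  obtain ⟨t, ht⟩ := (tendsto_hyp_cocompact.eventually hK.compl_mem_cocompact).exists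
  exact ht ⟨t, rfl⟩

/-- `A` is a closed non-compact subgroup (both facts in one statement). -/
theorem isClosed_and_noncompact_hypSubgroup :
    IsClosed (hypSubgroup : Set SU11) ∧ NoncompactSpace hypSubgroup :=
  ⟨isClosed_hypSubgroup, inferInstance⟩

end Summit.Ventures.HodgeRepro2.T5SU11HyperbolicSubgroup
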